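import Summits.CriticalPhenomena.PercolationContinuityZ3.Theorems.PercNearOneGluingNoHeavyConstsMDLXJoint
import Summits.CriticalPhenomena.PercolationContinuityZ3.Theorems.PercNearOneGluingNoHeavyConstsTwoSourceBHKMixed
import HarnessLib

/-!
# The conditioned marker inequality: `ν(Z | U, Y) ≥ p' + ν(Z | Uᶜ, N)` for every up-event `U` of the owner's cluster
# (PAPER-2 track (ii); seat `prim-consts-2`, gen 16 — part 1 of the Y-split of MDL(X)′, see `…ConstsMarkerSplit.lean`)

builds on p205010 (kernel theorem, internal audit signed; external expert review pending).  Support file (`--supports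
stmt-CriticalPhenomena-4575`); memo `run/shared/lean/prim/consts/FROM-prim-consts-2-g16-MARKER-SPLIT.md`.  Theorems only; no sorries; standard axioms.

Notation (as in `…ConstsMDLXJoint.lean`): owner `s`, avoided set `X`, markers `y, z`; `D = {s ↮ X}`, `T = {y ↮ {s}∪X} ∩ D`, `Y = {s ↔ y}`,
`N = Yᶜ`, `Z = {s ↔ z}`, `W = {y ↔ z}`, `p' = μ(T∩W)/μ(T)`, `ν = μ(·|D)`; `F` a monotone functional of the open edge cluster `C_s`.

* `Consts.conditionedMarker_ge` — **THEOREM (generalises the marker corner `Consts.mdlxJoint_connIndicator` of MDL(X)′ to every functional).**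
  For monotone `F ≥ 0` and antitone `G ≥ 0`:
  `(∫_{D∩Y} F)·(μ(T∩W) ∫_{D∩N} G + μ(T) ∫_{D∩N∩Z} G) ≤ (∫_{D∩Y∩Z} F)·μ(T)·∫_{D∩N} G`;
  for `F = 1_U`, `G = 1_{Uᶜ}` (`U` an up-event of `C_s`): `ν(Z | U, Y) ≥ p' + ν(Z | Uᶜ, N)` — conditioning on ANY increasing information about
  the owner's cluster together with `s ↔ y` makes `s ↔ z` at least as likely as the three-way link probability `p'` plus the probability of
  `s ↔ z` under the complementary (decreasing) information and `s ↮ y`.  PROOF: (1) van den Berg–Häggström–Kahn Thm 1.3 WITH SETS for the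
  source set `{s,y}` repelled from `X` (`E₁ = {s,y} ↮ X`, on which the edge set `K = C_s ∪ C_y` has a positively associated law): the
  functionals `F(K)·1{s↔y in K}` and `1{z ∈ V(K)}` are increasing — and `1{z ∈ V(K)}` against the antitone `1{s↮y in K}`
  (`Consts.twoSource_sameSource_mixed`) — whence `(∫_{D∩Y∩Z} F)·μ(T) ≥ (∫_{D∩Y} F)·μ(T∩(Z∪W))`; (2) the increasing/antitone inequality for the
  source `s` repelled from `X ∪ {y}`: `(∫_{D∩N∩Z} G)·μ(D∩N) ≤ (∫_{D∩N} G)·μ(D∩N∩Z)`; (3) Thm 1.4 with sets (`{s}` vs `X ∪ {y}`):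
  `μ(T)·μ(D∩N∩Z) ≤ μ(T∩Z)·μ(D∩N)`.
* `Consts.markerPA_ge` — `μ(D∩N∩Z)·∫_{D∩N} F ≤ μ(D∩N)·∫_{D∩N∩Z} F` (Thm 1.3 with sets, source `s` repelled from `X∪{y}`).
* bookkeeping lemmas on set integrals over the finite configuration space (`Consts.setIntegral_mul_indicator_one`,
  `Consts.setIntegral_inter_add_compl`, `Consts.setIntegral_one_sub`, `Consts.iUnion_pair_openEdgeCluster_eq`).
Exact numerical check (engines `prim-consts-2/g16/engines/split1.py`, `s0test.py`; all up-events of the realised edge-cluster poset, n ≤ 6):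
0 violations in > 40 000 (instance, U) pairs, as it must be.
[cite: VandenbergHaggstromKahn2005, Thm. 1.3 (p. 6), Thm. 1.4 (p. 7) with Remark 1 after Thm. 1.2 (p. 5); Thm. 2.1 (p. 9)]
-/

noncomputable section

namespace Summit.CriticalPhenomena.PercolationContinuityZ3.Theorems

open MeasureTheory Set Literature.Probability.LatticeModels Literature.Probability.Percolation
open scoped Classical

namespace Consts

variable {V : Type*} [Fintype V]

omit [Fintype V] in
/-- Vertices in the same open component have the same open edge cluster (so on `{s ↔ y}`, `C_s ∪ C_y = C_s`). [folklore] -/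
theorem iUnion_pair_openEdgeCluster_eq {ω : BondConfig V} {s y : V} (h : (openGraph ω).Reachable s y) :
    (⋃ a ∈ ({s, y} : Set V), openEdgeCluster ω a) = openEdgeCluster ω s := by
  have hy : openEdgeCluster ω y = openEdgeCluster ω s := by
    ext e
    simp only [mem_openEdgeCluster_iff]
    exact ⟨fun ⟨he, hd, hr⟩ => ⟨he, hd, fun v hv => h.trans (hr v hv)⟩,
      fun ⟨he, hd, hr⟩ => ⟨he, hd, fun v hv => h.symm.trans (hr v hv)⟩⟩
  ext e
  simp only [mem_iUnion, mem_insert_iff, mem_singleton_iff, exists_prop]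
  constructor
  · rintro ⟨a, (rfl | rfl), he⟩
    · exact he
    · rwa [hy] at he
  · intro he
    exact ⟨s, Or.inl rfl, he⟩

/-- On a finite configuration space every set integral of `f · 1_B` over `A` is the set integral of `f` over `A ∩ B`. [folklore] -/
theorem setIntegral_mul_indicator_one (μ : Measure (BondConfig V)) (A B : Set (BondConfig V)) (f : BondConfig V → ℝ) :
    ∫ ω in A, f ω * B.indicator 1 ω ∂μ = ∫ ω in A ∩ B, f ω ∂μ := by
  have h : (fun ω => f ω * B.indicator 1 ω) = B.indicator f := by
    funext ω
    by_cases hω : ω ∈ B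
    · rw [indicator_of_mem hω, indicator_of_mem hω, Pi.one_apply, mul_one]
    · rw [indicator_of_notMem hω, indicator_of_notMem hω, mul_zero]
  rw [h, setIntegral_indicator (MeasurableSet.of_discrete)]

/-- Splitting a set integral along an event and its complement (finite configuration space). [folklore] -/
theorem setIntegral_inter_add_compl (w : Sym2 V → unitInterval) (A B : Set (BondConfig V)) (f : BondConfig V → ℝ) :
    ∫ ω in A ∩ B, f ω ∂(prodBernoulli w) + ∫ ω in A ∩ Bᶜ, f ω ∂(prodBernoulli w) = ∫ ω in A, f ω ∂(prodBernoulli w) := by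
  have hdisj : Disjoint (A ∩ B) (A ∩ Bᶜ) :=
    Disjoint.mono inter_subset_right inter_subset_right disjoint_compl_right
  rw [← setIntegral_union hdisj MeasurableSet.of_discrete Integrable.of_finite.integrableOn
    Integrable.of_finite.integrableOn, inter_union_compl]

/-- `∫_A (1 − F) = μ(A) − ∫_A F` on a finite configuration space. [folklore] -/
theorem setIntegral_one_sub (w : Sym2 V → unitInterval) (A : Set (BondConfig V)) (f : BondConfig V → ℝ) :
    ∫ ω in A, (1 - f ω) ∂(prodBernoulli w) = (prodBernoulli w).real A - ∫ ω in A, f ω ∂(prodBernoulli w) := by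
  rw [integral_sub Integrable.of_finite Integrable.of_finite, setIntegral_const, smul_eq_mul, mul_one]

/-- **THEOREM (the conditioned marker inequality, `C2 ≥ 0`).**  For every finite weighted graph, `s, y, z`, `X`, every monotone `F ≥ 0` and
antitone `G ≥ 0` (functionals of the open edge cluster `C_s`):
`(∫_{D∩Y} F) · (μ(T∩W) ∫_{D∩N} G + μ(T) ∫_{D∩N∩Z} G) ≤ (∫_{D∩Y∩Z} F) · μ(T) · ∫_{D∩N} G`
(`D = {s↮X}`, `T = {y ↮ {s}∪X} ∩ D`, `Y = {s↔y}`, `N = Yᶜ`, `Z = {s↔z}`, `W = {y↔z}`); for `F = 1_U`, `G = 1_{Uᶜ}` (`U` an up-event of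
`C_s`): `ν(Z | U, Y) ≥ p' + ν(Z | Uᶜ, N)`.  Three steps: BHK Thm 1.3 with sets for the source set `{s,y}` (with the increasing/antitone
companion `Consts.twoSource_sameSource_mixed`), the same for the source `s` repelled from `X ∪ {y}`, and BHK Thm 1.4 with sets.
[cite: VandenbergHaggstromKahn2005, Thm. 1.3 (p. 6), Thm. 1.4 (p. 7) with Remark 1 after Thm. 1.2 (p. 5) — corollary derived here] -/
theorem conditionedMarker_ge (w : Sym2 V → unitInterval) (s y z : V) (X : Set V) (F G : Set (Sym2 V) → ℝ)
    (hF : Monotone F) (hG : Antitone G) (hF0 : ∀ C, 0 ≤ F C) (hG0 : ∀ C, 0 ≤ G C) :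
    (∫ ω in {ω : BondConfig V | ∀ x ∈ X, ¬ (openGraph ω).Reachable s x} ∩ openConn s y,
        F (openEdgeCluster ω s) ∂(prodBernoulli w)) *
      ((prodBernoulli w).real ({ω : BondConfig V | ∀ x ∈ insert s X, ¬ (openGraph ω).Reachable y x} ∩
          {ω | ∀ x ∈ X, ¬ (openGraph ω).Reachable s x} ∩ openConn y z) *
        (∫ ω in {ω : BondConfig V | ∀ x ∈ X, ¬ (openGraph ω).Reachable s x} ∩ (openConn s y)ᶜ,
          G (openEdgeCluster ω s) ∂(prodBernoulli w)) +
      (prodBernoulli w).real ({ω : BondConfig V | ∀ x ∈ insert s X, ¬ (openGraph ω).Reachable y x} ∩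
          {ω | ∀ x ∈ X, ¬ (openGraph ω).Reachable s x}) *
        (∫ ω in {ω : BondConfig V | ∀ x ∈ X, ¬ (openGraph ω).Reachable s x} ∩ (openConn s y)ᶜ ∩ openConn s z,
          G (openEdgeCluster ω s) ∂(prodBernoulli w))) ≤
    (∫ ω in {ω : BondConfig V | ∀ x ∈ X, ¬ (openGraph ω).Reachable s x} ∩ openConn s y ∩ openConn s z,
        F (openEdgeCluster ω s) ∂(prodBernoulli w)) *
      (prodBernoulli w).real ({ω : BondConfig V | ∀ x ∈ insert s X, ¬ (openGraph ω).Reachable y x} ∩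
          {ω | ∀ x ∈ X, ¬ (openGraph ω).Reachable s x}) *
      (∫ ω in {ω : BondConfig V | ∀ x ∈ X, ¬ (openGraph ω).Reachable s x} ∩ (openConn s y)ᶜ,
          G (openEdgeCluster ω s) ∂(prodBernoulli w)) := by
  classical
  set μ := prodBernoulli w with hμ
  have hmeas : ∀ S : Set (BondConfig V), MeasurableSet S := fun _ => MeasurableSet.of_discrete
  have h0 : ∀ S : Set (BondConfig V), 0 ≤ μ.real S := fun _ => measureReal_nonneg
  set D : Set (BondConfig V) := {ω | ∀ x ∈ X, ¬ (openGraph ω).Reachable s x} with hD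
  set A : Set (BondConfig V) := {ω | ∀ x ∈ insert s X, ¬ (openGraph ω).Reachable y x} with hA
  set Yv : Set (BondConfig V) := openConn s y with hYv
  set Zv : Set (BondConfig V) := openConn s z with hZv
  set Wv : Set (BondConfig V) := openConn y z with hWv
  set E₁ : Set (BondConfig V) := {ω | ∀ a ∈ ({s, y} : Set V), ∀ x ∈ X, ¬ (openGraph ω).Reachable a x} with hE₁
  set E₂ : Set (BondConfig V) := {ω | ∀ a ∈ ({s} : Set V), ∀ x ∈ insert y X, ¬ (openGraph ω).Reachable a x} with hE₂
  set Gy : Set (BondConfig V) := {ω | ∃ x ∈ X, (openGraph ω).Reachable y x} with hGy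
  set T : Set (BondConfig V) := A ∩ D with hT
  set Gv : Set (BondConfig V) := D ∩ Gy with hGv
  set f : BondConfig V → ℝ := fun ω => F (openEdgeCluster ω s) with hf
  set g : BondConfig V → ℝ := fun ω => G (openEdgeCluster ω s) with hg
  have mD : ∀ ω, ω ∈ D ↔ ∀ x ∈ X, ¬ (openGraph ω).Reachable s x := fun ω => Iff.rfl
  have mA : ∀ ω, ω ∈ A ↔ ¬ (openGraph ω).Reachable y s ∧ ∀ x ∈ X, ¬ (openGraph ω).Reachable y x := by
    intro ω; simp only [hA, mem_setOf_eq, mem_insert_iff, forall_eq_or_imp]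
  have mE₁ : ∀ ω, ω ∈ E₁ ↔ (∀ x ∈ X, ¬ (openGraph ω).Reachable s x) ∧ ∀ x ∈ X, ¬ (openGraph ω).Reachable y x := by
    intro ω; simp only [hE₁, mem_setOf_eq, mem_insert_iff, mem_singleton_iff, forall_eq_or_imp, forall_eq]
  have mE₂ : ∀ ω, ω ∈ E₂ ↔ ¬ (openGraph ω).Reachable s y ∧ ∀ x ∈ X, ¬ (openGraph ω).Reachable s x := by
    intro ω; simp only [hE₂, mem_setOf_eq, mem_singleton_iff, forall_eq, mem_insert_iff, forall_eq_or_imp]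
  have mY : ∀ ω, ω ∈ Yv ↔ (openGraph ω).Reachable s y := fun ω => Iff.rfl
  have mZ : ∀ ω, ω ∈ Zv ↔ (openGraph ω).Reachable s z := fun ω => Iff.rfl
  have mW : ∀ ω, ω ∈ Wv ↔ (openGraph ω).Reachable y z := fun ω => Iff.rfl
  have mGy : ∀ ω, ω ∈ Gy ↔ ∃ x ∈ X, (openGraph ω).Reachable y x := fun ω => Iff.rfl
  -- set identities
  have sDY : E₁ ∩ Yv = D ∩ Yv := by
    ext ω; simp only [mem_inter_iff, mE₁, mD, mY]
    constructor
    · rintro ⟨⟨h, -⟩, hsy⟩; exact ⟨h, hsy⟩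
    · rintro ⟨h, hsy⟩; exact ⟨⟨h, fun x hx hr => h x hx (hsy.trans hr)⟩, hsy⟩
  have sT : T = E₁ ∩ Yvᶜ := by
    ext ω; simp only [hT, mem_inter_iff, mA, mD, mE₁, mem_compl_iff, mY]
    constructor
    · rintro ⟨⟨hys, hyX⟩, hsX⟩; exact ⟨⟨hsX, hyX⟩, fun h => hys h.symm⟩
    · rintro ⟨⟨hsX, hyX⟩, hsy⟩; exact ⟨⟨fun h => hsy h.symm, hyX⟩, hsX⟩
  have sE₂ : E₂ = D ∩ Yvᶜ := by
    ext ω; simp only [mE₂, mem_inter_iff, mD, mem_compl_iff, mY]; tauto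
  have sDN : D ∩ Yvᶜ = T ∪ Gv := by
    ext ω; simp only [mem_inter_iff, mem_compl_iff, mem_union, sT, hGv, mE₁, mD, mY, mGy]
    constructor
    · rintro ⟨hsX, hsy⟩
      by_cases hyx : ∃ x ∈ X, (openGraph ω).Reachable y x
      · exact Or.inr ⟨hsX, hyx⟩
      · simp only [not_exists, not_and] at hyx; exact Or.inl ⟨⟨hsX, hyx⟩, hsy⟩
    · rintro (⟨⟨hsX, -⟩, hsy⟩ | ⟨hsX, ⟨x, hx, hr⟩⟩)
      · exact ⟨hsX, hsy⟩
      · exact ⟨hsX, fun hsy => hsX x hx (hsy.trans hr)⟩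
  have dDN : Disjoint T Gv := by
    rw [Set.disjoint_left]
    rintro ω hT' ⟨-, ⟨x, hx, hr⟩⟩
    rw [sT] at hT'
    exact ((mE₁ ω).1 hT'.1).2 x hx hr
  have sZW : E₁ ∩ Yvᶜ ∩ (Zv ∪ Wv) = T ∩ Zv ∪ T ∩ Wv := by
    rw [← sT, inter_union_distrib_left]
  have dZW : Disjoint (T ∩ Zv) (T ∩ Wv) := by
    rw [Set.disjoint_left]
    rintro ω ⟨hT', hsz⟩ ⟨-, hyz⟩
    rw [sT] at hT'
    exact hT'.2 ((show (openGraph ω).Reachable s z from hsz).trans (show (openGraph ω).Reachable y z from hyz).symm)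
  have sYZW : E₁ ∩ (Yv ∩ (Zv ∪ Wv)) = D ∩ Yv ∩ Zv := by
    rw [← sDY]
    ext ω; simp only [mem_inter_iff, mem_union, mY, mZ, mW]
    constructor
    · rintro ⟨h1, hsy, hzw⟩
      exact ⟨⟨h1, hsy⟩, hzw.elim id fun hyz => hsy.trans hyz⟩
    · rintro ⟨⟨h1, hsy⟩, hsz⟩; exact ⟨h1, hsy, Or.inl hsz⟩
  /- STEP 1: BHK Thm 1.3 with sets for the source set `{s,y}` repelled from `X`, functionals `Φ(K) = F(K)·1{s↔y in K}` and
     `H(K) = 1{s↔z or y↔z in K}`; then the increasing/antitone form for `H` and `1{s↮y in K}`. -/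
  set Φ : Set (Sym2 V) → ℝ := fun C => F C * (if (openGraph C).Reachable s y then 1 else 0) with hΦ
  set H : Set (Sym2 V) → ℝ := fun C => if (openGraph C).Reachable s z ∨ (openGraph C).Reachable y z then 1 else 0 with hH
  set Nf : Set (Sym2 V) → ℝ := fun C => if (openGraph C).Reachable s y then 0 else 1 with hNf
  have hΦm : Monotone Φ := by
    intro C C' h; simp only [hΦ]
    by_cases hc : (openGraph C).Reachable s y
    · rw [if_pos hc, if_pos (hc.mono (openGraph_mono h)), mul_one, mul_one]; exact hF h
    · rw [if_neg hc, mul_zero]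
      exact mul_nonneg (hF0 _) (by split_ifs <;> norm_num)
  have hHm : Monotone H := by
    intro C C' h; simp only [hH]
    by_cases hc : (openGraph C).Reachable s z ∨ (openGraph C).Reachable y z
    · rw [if_pos hc, if_pos (hc.imp (fun hr => hr.mono (openGraph_mono h)) (fun hr => hr.mono (openGraph_mono h)))]
    · rw [if_neg hc]; split_ifs <;> norm_num
  have hNfa : Antitone Nf := by
    intro C C' h; simp only [hNf]
    by_cases hc : (openGraph C).Reachable s y
    · rw [if_pos hc, if_pos (hc.mono (openGraph_mono h))]
    · rw [if_neg hc]; split_ifs <;> norm_num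
  have hH0 : ∀ C, 0 ≤ H C := fun C => by simp only [hH]; split_ifs <;> norm_num
  have hNf0 : ∀ C, 0 ≤ Nf C := fun C => by simp only [hNf]; split_ifs <;> norm_num
  -- reading the functionals on a configuration
  have rY : ∀ ω : BondConfig V, (openGraph (⋃ a ∈ ({s, y} : Set V), openEdgeCluster ω a)).Reachable s y ↔
      (openGraph ω).Reachable s y := fun ω => (KNSep.reachable_iff_cluster ω ({s, y} : Set V) (mem_insert s {y}) y).symm
  have rZW : ∀ ω : BondConfig V, ((openGraph (⋃ a ∈ ({s, y} : Set V), openEdgeCluster ω a)).Reachable s z ∨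
      (openGraph (⋃ a ∈ ({s, y} : Set V), openEdgeCluster ω a)).Reachable y z) ↔ ω ∈ Zv ∪ Wv := by
    intro ω
    rw [← KNSep.reachable_iff_cluster ω ({s, y} : Set V) (mem_insert s {y}) z,
      ← KNSep.reachable_iff_cluster ω ({s, y} : Set V) (mem_insert_of_mem s (mem_singleton y)) z]
    rfl
  have hΦω : ∀ ω : BondConfig V, Φ (⋃ a ∈ ({s, y} : Set V), openEdgeCluster ω a) = f ω * Yv.indicator 1 ω := by
    intro ω
    simp only [hΦ, rY]
    by_cases h : (openGraph ω).Reachable s y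
    · rw [if_pos h, indicator_of_mem (show ω ∈ Yv from h), Pi.one_apply, iUnion_pair_openEdgeCluster_eq h]
    · rw [if_neg h, indicator_of_notMem (show ω ∉ Yv from h), mul_zero, mul_zero]
  have hHω : ∀ ω : BondConfig V, H (⋃ a ∈ ({s, y} : Set V), openEdgeCluster ω a) = (Zv ∪ Wv).indicator 1 ω := by
    intro ω
    simp only [hH, rZW]
    by_cases h : ω ∈ Zv ∪ Wv
    · rw [if_pos h, indicator_of_mem h, Pi.one_apply]
    · rw [if_neg h, indicator_of_notMem h]
  have hNfω : ∀ ω : BondConfig V, Nf (⋃ a ∈ ({s, y} : Set V), openEdgeCluster ω a) = Yvᶜ.indicator 1 ω := by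
    intro ω
    simp only [hNf, rY]
    by_cases h : (openGraph ω).Reachable s y
    · rw [if_pos h, indicator_of_notMem (show ω ∉ Yvᶜ from fun h' => h' h)]
    · rw [if_neg h, indicator_of_mem (show ω ∈ Yvᶜ from h), Pi.one_apply]
  -- (1a) positive association of K = C_{s,y} given E₁
  have hQ := BHK2006_setClusterConditionalPositiveAssociation w ({s, y} : Set V) X Φ H hΦm hHm
  have hΦH : ∀ ω : BondConfig V, f ω * Yv.indicator 1 ω * (Zv ∪ Wv).indicator 1 ω =
      f ω * (Yv ∩ (Zv ∪ Wv)).indicator 1 ω := by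
    intro ω
    rw [mul_assoc]
    congr 1
    by_cases h1 : ω ∈ Yv
    · by_cases h2 : ω ∈ Zv ∪ Wv
      · rw [indicator_of_mem h1, indicator_of_mem h2, indicator_of_mem (mem_inter h1 h2), Pi.one_apply, mul_one]
      · rw [indicator_of_notMem h2, indicator_of_notMem (show ω ∉ Yv ∩ (Zv ∪ Wv) from fun h => h2 h.2), mul_zero]
    · rw [indicator_of_notMem h1, indicator_of_notMem (show ω ∉ Yv ∩ (Zv ∪ Wv) from fun h => h1 h.1), zero_mul]
  simp only [hΦω, hHω] at hQ
  simp only [hΦH] at hQ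
  change (∫ ω in E₁, f ω * Yv.indicator 1 ω ∂μ) * (∫ ω in E₁, (Zv ∪ Wv).indicator 1 ω ∂μ) ≤
    μ.real E₁ * ∫ ω in E₁, f ω * (Yv ∩ (Zv ∪ Wv)).indicator 1 ω ∂μ at hQ
  rw [setIntegral_mul_indicator_one, setIntegral_mul_indicator_one, TripodExchange.setIntegral_indicator_one_eq,
    sDY, sYZW] at hQ
  -- hQ : (∫_{D∩Y} f) * μ(E₁ ∩ (Z∪W)) ≤ μ(E₁) * ∫_{D∩Y∩Z} f
  -- (1b) increasing `H` against antitone `Nf` given E₁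
  have hM := twoSource_sameSource_mixed w ({s, y} : Set V) X X H Nf hHm hNfa hH0 hNf0
  simp only [Set.inter_self, Set.union_self, hHω, hNfω] at hM
  change (∫ ω in E₁, (Zv ∪ Wv).indicator 1 ω * Yvᶜ.indicator 1 ω ∂μ) * μ.real E₁ ≤
    (∫ ω in E₁, (Zv ∪ Wv).indicator 1 ω ∂μ) * ∫ ω in E₁, Yvᶜ.indicator 1 ω ∂μ at hM
  rw [TripodExchange.setIntegral_indicator_mul_indicator_eq, TripodExchange.setIntegral_indicator_one_eq,
    TripodExchange.setIntegral_indicator_one_eq] at hM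
  -- hM : μ(E₁ ∩ ((Z∪W) ∩ Yᶜ)) * μ(E₁) ≤ μ(E₁ ∩ (Z∪W)) * μ(E₁ ∩ Yᶜ)
  have e1 : E₁ ∩ ((Zv ∪ Wv) ∩ Yvᶜ) = T ∩ Zv ∪ T ∩ Wv := by
    rw [← sZW, inter_comm (Zv ∪ Wv) Yvᶜ, inter_assoc]
  rw [e1, measureReal_union dZW (hmeas _), ← sT] at hM
  -- STEP 1 combined: (∫_{D∩Y} f)·(μ(T∩Z)+μ(T∩W)) ≤ (∫_{D∩Y∩Z} f)·μ(T)
  have hIY0 : 0 ≤ ∫ ω in D ∩ Yv, f ω ∂μ := setIntegral_nonneg (hmeas _) fun ω _ => hF0 _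
  have hIYZ0 : 0 ≤ ∫ ω in D ∩ Yv ∩ Zv, f ω ∂μ := setIntegral_nonneg (hmeas _) fun ω _ => hF0 _
  have step1 : (∫ ω in D ∩ Yv, f ω ∂μ) * (μ.real (T ∩ Zv) + μ.real (T ∩ Wv)) ≤
      (∫ ω in D ∩ Yv ∩ Zv, f ω ∂μ) * μ.real T := by
    by_cases hE : μ.real E₁ = 0
    · have hT0 : μ.real T = 0 := le_antisymm ((measureReal_mono (by rw [sT]; exact inter_subset_left)).trans hE.le) (h0 _)
      have hTZ : μ.real (T ∩ Zv) = 0 := le_antisymm ((measureReal_mono inter_subset_left).trans hT0.le) (h0 _)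
      have hTW : μ.real (T ∩ Wv) = 0 := le_antisymm ((measureReal_mono inter_subset_left).trans hT0.le) (h0 _)
      rw [hT0, hTZ, hTW]; simp
    · have hEpos : 0 < μ.real E₁ := lt_of_le_of_ne (h0 _) (Ne.symm hE)
      -- (∫_{DY} f)(μTZ+μTW) μE₁ ≤ (∫_{DY} f) μ(E₁∩(Z∪W)) μT ≤ μE₁ (∫_{DYZ} f) μT
      have h2 : (∫ ω in D ∩ Yv, f ω ∂μ) * ((μ.real (T ∩ Zv) + μ.real (T ∩ Wv)) * μ.real E₁) ≤
          (∫ ω in D ∩ Yv, f ω ∂μ) * (μ.real (E₁ ∩ (Zv ∪ Wv)) * μ.real T) :=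
        mul_le_mul_of_nonneg_left hM hIY0
      have h3 : (∫ ω in D ∩ Yv, f ω ∂μ) * μ.real (E₁ ∩ (Zv ∪ Wv)) * μ.real T ≤
          μ.real E₁ * (∫ ω in D ∩ Yv ∩ Zv, f ω ∂μ) * μ.real T :=
        mul_le_mul_of_nonneg_right hQ (h0 _)
      have h4 : ((∫ ω in D ∩ Yv, f ω ∂μ) * (μ.real (T ∩ Zv) + μ.real (T ∩ Wv))) * μ.real E₁ ≤
          ((∫ ω in D ∩ Yv ∩ Zv, f ω ∂μ) * μ.real T) * μ.real E₁ := by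
        nlinarith [h2, h3]
      exact le_of_mul_le_mul_right h4 hEpos
  /- STEP 2: increasing `1{s↔z}` against antitone `G` for the source `s` repelled from `X ∪ {y}` (`E₂ = D ∩ N`). -/
  have hB := twoSource_sameSource_mixed w ({s} : Set V) (insert y X) (insert y X) (connIndicatorFn s z) G
    (monotone_connIndicatorFn s z) hG (fun C => by unfold connIndicatorFn; split_ifs <;> norm_num) hG0
  have hCs : ∀ ω : BondConfig V, (⋃ a ∈ ({s} : Set V), openEdgeCluster ω a) = openEdgeCluster ω s := fun ω => by
    ext e; simp
  simp only [Set.inter_self, Set.union_self, hCs, connIndicatorFn_openEdgeCluster] at hB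
  change (∫ ω in E₂, Zv.indicator 1 ω * g ω ∂μ) * μ.real E₂ ≤ (∫ ω in E₂, Zv.indicator 1 ω ∂μ) * ∫ ω in E₂, g ω ∂μ at hB
  have eZg : (fun ω => Zv.indicator 1 ω * g ω) = fun ω => g ω * Zv.indicator 1 ω := by funext ω; ring
  rw [eZg, setIntegral_mul_indicator_one, TripodExchange.setIntegral_indicator_one_eq, sE₂] at hB
  -- hB : (∫_{D∩N∩Z} g) * μ(D∩N) ≤ μ(D∩N∩Z) * ∫_{D∩N} g
  /- STEP 3: BHK Thm 1.4 with sets, `{s}` vs `X ∪ {y}`: μ(T) μ(D∩N∩Z) ≤ μ(T∩Z) μ(D∩N). -/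
  set G₂ : Set (Sym2 V) → ℝ := fun C => if ∃ x ∈ X, (openGraph C).Reachable y x then 1 else 0 with hG₂
  have hG₂m : Monotone G₂ := by
    refine TripodExchange.predIndicator_monotone ?_
    rintro C C' hCC' ⟨x, hx, hr⟩
    exact ⟨x, hx, hr.mono (openGraph_mono hCC')⟩
  have hG₂ω : ∀ ω : BondConfig V, G₂ (⋃ t ∈ insert y X, openEdgeCluster ω t) = Gy.indicator 1 ω := by
    intro ω
    have hiff : (∃ x ∈ X, (openGraph (⋃ t ∈ insert y X, openEdgeCluster ω t)).Reachable y x) ↔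
        ∃ x ∈ X, (openGraph ω).Reachable y x := by
      constructor
      · rintro ⟨x, hx, hr⟩
        exact ⟨x, hx, (KNSep.reachable_iff_cluster ω (insert y X) (mem_insert y X) x).2 hr⟩
      · rintro ⟨x, hx, hr⟩
        exact ⟨x, hx, (KNSep.reachable_iff_cluster ω (insert y X) (mem_insert y X) x).1 hr⟩
    simp only [hG₂, hiff]
    exact TwoSetConditionalAssociation.predIndicator_eq_indicator (fun ω' => ∃ x ∈ X, (openGraph ω').Reachable y x) ω
  have hR0 := BHK2006_twoSetConditionalAssociation.negCorrelation w ({s} : Set V) (insert y X) (connIndicatorFn s z) G₂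
    (monotone_connIndicatorFn s z) hG₂m
  simp only [hCs, connIndicatorFn_openEdgeCluster, hG₂ω] at hR0
  change μ.real E₂ * (∫ ω in E₂, Zv.indicator 1 ω * Gy.indicator 1 ω ∂μ) ≤
    (∫ ω in E₂, Zv.indicator 1 ω ∂μ) * ∫ ω in E₂, Gy.indicator 1 ω ∂μ at hR0
  rw [TripodExchange.setIntegral_indicator_one_eq, TripodExchange.setIntegral_indicator_one_eq,
    TripodExchange.setIntegral_indicator_mul_indicator_eq] at hR0
  -- hR0 : μ E₂ * μ(E₂ ∩ (Zv ∩ Gy)) ≤ μ(E₂ ∩ Zv) * μ(E₂ ∩ Gy)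
  have sE₂G : E₂ ∩ Gy = Gv := by
    ext ω; simp only [mem_inter_iff, mE₂, hGv, mD, mGy]
    constructor
    · rintro ⟨⟨-, hsX⟩, hyx⟩; exact ⟨hsX, hyx⟩
    · rintro ⟨hsX, ⟨x, hx, hr⟩⟩; exact ⟨⟨fun hsy => hsX x hx (hsy.trans hr), hsX⟩, ⟨x, hx, hr⟩⟩
  have sE₂ZG : E₂ ∩ (Zv ∩ Gy) = Gv ∩ Zv := by
    rw [inter_comm Zv Gy, ← inter_assoc, sE₂G]
  have sE₂Z : E₂ ∩ Zv = T ∩ Zv ∪ Gv ∩ Zv := by rw [sE₂, sDN, union_inter_distrib_right]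
  have dTGZ : Disjoint (T ∩ Zv) (Gv ∩ Zv) := dDN.mono inter_subset_left inter_subset_left
  rw [sE₂ZG, sE₂Z, sE₂G, sE₂, sDN, measureReal_union dDN (hmeas _), measureReal_union dTGZ (hmeas _)] at hR0
  -- hR0 : (μT + μG) * μ(G∩Z) ≤ (μ(T∩Z) + μ(G∩Z)) * μ G
  have eDN : μ.real (D ∩ Yvᶜ) = μ.real T + μ.real Gv := by rw [sDN, measureReal_union dDN (hmeas _)]
  have eDNZ : μ.real (D ∩ Yvᶜ ∩ Zv) = μ.real (T ∩ Zv) + μ.real (Gv ∩ Zv) := by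
    rw [sDN, union_inter_distrib_right, measureReal_union dTGZ (hmeas _)]
  have step3 : μ.real T * μ.real (D ∩ Yvᶜ ∩ Zv) ≤ μ.real (T ∩ Zv) * μ.real (D ∩ Yvᶜ) := by
    rw [eDN, eDNZ]; nlinarith [hR0, h0 T, h0 (T ∩ Zv)]
  /- assembly -/
  have hJ0 : 0 ≤ ∫ ω in D ∩ Yvᶜ, g ω ∂μ := setIntegral_nonneg (hmeas _) fun ω _ => hG0 _
  have hJZ0 : 0 ≤ ∫ ω in D ∩ Yvᶜ ∩ Zv, g ω ∂μ := setIntegral_nonneg (hmeas _) fun ω _ => hG0 _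
  by_cases hDN0 : μ.real (D ∩ Yvᶜ) = 0
  · -- degenerate: T ⊆ D ∩ N is null
    have hT0 : μ.real T = 0 :=
      le_antisymm ((measureReal_mono (show T ⊆ D ∩ Yvᶜ by rw [sDN]; exact subset_union_left)).trans hDN0.le) (h0 _)
    have hTW : μ.real (T ∩ Wv) = 0 := le_antisymm ((measureReal_mono inter_subset_left).trans hT0.le) (h0 _)
    rw [hT0, hTW]; simp
  · have hpos : 0 < μ.real (D ∩ Yvᶜ) := lt_of_le_of_ne (h0 _) (Ne.symm hDN0)
    -- μT · J_Z ≤ μ(T∩Z) · J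
    have k1 : μ.real T * (∫ ω in D ∩ Yvᶜ ∩ Zv, g ω ∂μ) * μ.real (D ∩ Yvᶜ) ≤
        μ.real (T ∩ Zv) * (∫ ω in D ∩ Yvᶜ, g ω ∂μ) * μ.real (D ∩ Yvᶜ) := by
      calc μ.real T * (∫ ω in D ∩ Yvᶜ ∩ Zv, g ω ∂μ) * μ.real (D ∩ Yvᶜ)
          = μ.real T * ((∫ ω in D ∩ Yvᶜ ∩ Zv, g ω ∂μ) * μ.real (D ∩ Yvᶜ)) := by ring
        _ ≤ μ.real T * (μ.real (D ∩ Yvᶜ ∩ Zv) * ∫ ω in D ∩ Yvᶜ, g ω ∂μ) :=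
          mul_le_mul_of_nonneg_left hB (h0 _)
        _ = (μ.real T * μ.real (D ∩ Yvᶜ ∩ Zv)) * ∫ ω in D ∩ Yvᶜ, g ω ∂μ := by ring
        _ ≤ (μ.real (T ∩ Zv) * μ.real (D ∩ Yvᶜ)) * ∫ ω in D ∩ Yvᶜ, g ω ∂μ :=
          mul_le_mul_of_nonneg_right step3 hJ0
        _ = _ := by ring
    have k2 : μ.real T * (∫ ω in D ∩ Yvᶜ ∩ Zv, g ω ∂μ) ≤ μ.real (T ∩ Zv) * (∫ ω in D ∩ Yvᶜ, g ω ∂μ) :=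
      le_of_mul_le_mul_right k1 hpos
    have k3 := mul_le_mul_of_nonneg_left k2 hIY0
    have k4 := mul_le_mul_of_nonneg_right step1 hJ0
    nlinarith [k3, k4, h0 (T ∩ Wv), h0 (T ∩ Zv), h0 T, hIY0, hIYZ0, hJ0, hJZ0]

/-- **`P1 ≥ 0`**: `μ(D∩N∩Z) · ∫_{D∩N} F ≤ μ(D∩N) · ∫_{D∩N∩Z} F` for monotone `F` — van den Berg–Häggström–Kahn's Theorem 1.3 with sets for the
source `s` repelled from `X ∪ {y}` (`D ∩ N = {s ↮ X ∪ {y}}`), with `1{s↔z}`. [cite: VandenbergHaggstromKahn2005, Thm. 1.3 (p. 6), Remark 1 (p. 5)] -/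
theorem markerPA_ge (w : Sym2 V → unitInterval) (s y z : V) (X : Set V) (F : Set (Sym2 V) → ℝ) (hF : Monotone F) :
    (prodBernoulli w).real ({ω : BondConfig V | ∀ x ∈ X, ¬ (openGraph ω).Reachable s x} ∩ (openConn s y)ᶜ ∩ openConn s z) *
      (∫ ω in {ω : BondConfig V | ∀ x ∈ X, ¬ (openGraph ω).Reachable s x} ∩ (openConn s y)ᶜ,
        F (openEdgeCluster ω s) ∂(prodBernoulli w)) ≤
    (prodBernoulli w).real ({ω : BondConfig V | ∀ x ∈ X, ¬ (openGraph ω).Reachable s x} ∩ (openConn s y)ᶜ) *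
      (∫ ω in {ω : BondConfig V | ∀ x ∈ X, ¬ (openGraph ω).Reachable s x} ∩ (openConn s y)ᶜ ∩ openConn s z,
        F (openEdgeCluster ω s) ∂(prodBernoulli w)) := by
  classical
  set μ := prodBernoulli w with hμ
  set D : Set (BondConfig V) := {ω | ∀ x ∈ X, ¬ (openGraph ω).Reachable s x} with hD
  set Yv : Set (BondConfig V) := openConn s y with hYv
  set Zv : Set (BondConfig V) := openConn s z with hZv
  set E₂ : Set (BondConfig V) := {ω | ∀ a ∈ ({s} : Set V), ∀ x ∈ insert y X, ¬ (openGraph ω).Reachable a x} with hE₂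
  have mE₂ : ∀ ω, ω ∈ E₂ ↔ ¬ (openGraph ω).Reachable s y ∧ ∀ x ∈ X, ¬ (openGraph ω).Reachable s x := by
    intro ω; simp only [hE₂, mem_setOf_eq, mem_singleton_iff, forall_eq, mem_insert_iff, forall_eq_or_imp]
  have sE₂ : E₂ = D ∩ Yvᶜ := by
    ext ω; simp only [mE₂, mem_inter_iff, hD, mem_setOf_eq, mem_compl_iff, hYv, openConn]; tauto
  have hCs : ∀ ω : BondConfig V, (⋃ a ∈ ({s} : Set V), openEdgeCluster ω a) = openEdgeCluster ω s := fun ω => by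
    ext e; simp
  have hP := BHK2006_setClusterConditionalPositiveAssociation w ({s} : Set V) (insert y X) (connIndicatorFn s z) F
    (monotone_connIndicatorFn s z) hF
  simp only [hCs, connIndicatorFn_openEdgeCluster] at hP
  change (∫ ω in E₂, Zv.indicator 1 ω ∂μ) * (∫ ω in E₂, F (openEdgeCluster ω s) ∂μ) ≤
    μ.real E₂ * ∫ ω in E₂, Zv.indicator 1 ω * F (openEdgeCluster ω s) ∂μ at hP
  have eZg : (fun ω => Zv.indicator 1 ω * F (openEdgeCluster ω s)) = fun ω => F (openEdgeCluster ω s) * Zv.indicator 1 ω := by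
    funext ω; ring
  rw [eZg, setIntegral_mul_indicator_one, TripodExchange.setIntegral_indicator_one_eq, sE₂] at hP
  exact hP

end Consts

end Summit.CriticalPhenomena.PercolationContinuityZ3.Theorems

end
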